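import Summits.FinalStateConjecture.FinalStateConjecture.Theses.RobustClausewiseGenericity
import Summits.FinalStateConjecture.FinalStateConjecture.Theses.BartnikGapSettling
import Summits.FinalStateConjecture.FinalStateConjecture.Theorems.RobustClausewiseGenericityAssembly
import Summits.FinalStateConjecture.FinalStateConjecture.Theorems.RobustClausewiseGenericityGaugeEnrichment

/-!
# Crux `GenericCensorshipCollarMargin` (stmt-FinalStateConjecture-10809) — ORDER-TWO ASSEMBLY PROBE (lead c3)

Kernel-checked form of the recommendation of `VERDICT-c3.md`: at the order the consumer forces
(`k₁ = 2`), with label AND boost windows, the restated crux is NOT an independent crux but an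
ASSEMBLY over the landed robust-genericity kernel
(`Theorems/RobustClausewiseGenericityAssembly.lean`, p121403): it follows in forty lines from the
shared item `CensorshipRobust` (stmt-FinalStateConjecture-10131, BY NAME) and ONE new crux-sized
item `CollarThirdLawRobust` — the collar-form, robust (tame-probe) third law of black-hole mechanics
at metric order 2 — with `GaugeEnrichment` discharged (`gaugeEnrichment`, p115620).

* `Margin₂` — the order-2 windowed bounded-boost collar-margin property of ONE datum (verbatim the
  second conjunct of C‴ with `k₁ := 2`; H4/H5 hygiene of `HYGIENE-c2.md` would be inserted here).
* `CollarThirdLawRobust` — CANDIDATE ITEM TEXT: `Margin₂` is robustly escapable at every admissible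
  datum. Its exceptional set is the extremal threshold (data forming a C²-settling asymptotically
  extremal hole, hairy or not — LR/Gajic hair is invisible at order 2) plus census failures;
  its truth is Kehle–Unger's "extremality is a threshold phenomenon" in transversal form.
* `GenericCensorshipCollarMargin₂` — CANDIDATE RESTATED CRUX: C‴ with `k₁` pinned to `2`.
* `genericCensorshipCollarMargin₂_of : CensorshipRobust → CollarThirdLawRobust → GenericCensorshipCollarMargin₂`
  — PROVED (conjoin, monotone, `isChristodoulouGeneric_of_robustlyEscapable` with `gaugeEnrichment`).

Nothing here is registered or filed (D-0014: restating is the planner's); this file only certifies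
that the recommended restatement elaborates and that its assembly is a theorem today.
-/

noncomputable section

set_option linter.dupNamespace false

open Set Filter Topology
open scoped Manifold ContDiff Topology ENNReal

namespace Summit.FinalStateConjecture.FinalStateConjecture.Cruxes.GenericCensorshipCollarMargin.OrderTwoAssembly

open Literature.Geometry.Lorentzian
open Summit.FinalStateConjecture.FinalStateConjecture.Theses.RobustClausewiseGenericity (CensorshipRobust)
open Summit.FinalStateConjecture.FinalStateConjecture.Theorems.RobustClausewiseGenericity

/-- The boost size of a motion `mo = (Λ, c)`: `max ‖Λ‖ ‖Λ⁻¹‖`. -/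
abbrev boostNorm (mo : lorentzGroup × E4) : ℝ :=
  max ‖((mo.1 : E4 ≃L[ℝ] E4) : E4 →L[ℝ] E4)‖ ‖((mo.1 : E4 ≃L[ℝ] E4).symm : E4 →L[ℝ] E4)‖

section

variable {X : Type} [TopologicalSpace X] [ChartedSpace E3 X] [IsManifold (𝓡 3) ∞ X] [ConnectedSpace X]

/-- **The order-2 windowed bounded-boost collar margin of ONE datum**: every MGHD satisfies, for every
label window `[m₀, m₀⁻¹]` and boost bound `ρ₀`, the clause with the tolerance order PINNED TO `2`. -/
abbrev Margin₂ (D : InitialDataSet (𝓡 3) X) : Prop :=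
  ∀ 𝒟 : VacuumCauchyDevelopment D, 𝒟.IsMaximal →
    ∀ m₀ ρ₀ : ℝ, 0 < m₀ → 0 < ρ₀ →
      ∃ (χ₁ : ℝ) (δ₁ : ENNReal) (K₁ : Set 𝒟.carrier), χ₁ < 1 ∧ 0 < δ₁ ∧ IsCompact K₁ ∧
        ∀ (M₁ a₁ : ℝ) (mo₁ : lorentzGroup × E4) (B₁ : ModelBackground)
          (Φ₁ : B₁.domain → 𝒟.carrier), m₀ ≤ M₁ → M₁ ≤ m₀⁻¹ → boostNorm mo₁ ≤ ρ₀ → |a₁| ≤ M₁ →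
          B₁ = starBackground mo₁.1 mo₁.2 M₁ a₁
            (fun x => Kerr.radius a₁ (poincareInv mo₁.1 mo₁.2 x)) →
          ContMDiffOn 𝓘(ℝ, E4) (𝓡 4) ((⊤ : ℕ∞) : WithTop ℕ∞) Φ₁
            {x | -1 < B₁.time x.1 ∧ B₁.time x.1 < 1 ∧ B₁.radius x.1 < 3 * M₁ + 1} →
          Topology.IsOpenEmbedding
            ({x | -1 < B₁.time x.1 ∧ B₁.time x.1 < 1 ∧
                B₁.radius x.1 < 3 * M₁ + 1}.restrict Φ₁) →
          𝒟.toSpacetime.truncDeviationCk B₁ Φ₁ 2 (3 * M₁) 0 ≤ δ₁ →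
          Disjoint (Φ₁ '' B₁.truncTimeSlab (3 * M₁) 0)
            (𝒟.metric.causalPast 𝒟.timeOrientation K₁) →
          |a₁| ≤ χ₁ * M₁

/-- The censorship half (verbatim the `Q` of `CensorshipRobust`). -/
abbrev Scri (D : InitialDataSet (𝓡 3) X) : Prop :=
  ∀ 𝒟 : VacuumCauchyDevelopment D, 𝒟.IsMaximal →
    Summit.FinalStateConjecture.HasCompleteNullInfinity 𝒟.toCauchyDevelopment

end

/-- **CANDIDATE ITEM `CollarThirdLawRobust` — the robust collar-form third law at metric order 2.**
At every admissible datum `d`, the order-2 windowed bounded-boost collar margin `Margin₂` is ROBUSTLY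
ESCAPABLE (`Theorems.RobustClausewiseGenericity.RobustlyEscapable`, the landed legend of route
`RobustClausewiseGenericity`): every tame probe through `d` enriches so that along every further tame
enrichment an open dense set of radial directions has `Margin₂` for all small parameters `≠ 0`.
WHY IT MIGHT FAIL: the exceptional set is the extremal threshold (C²-settling asymptotically extremal
holes, hairy or not) — its codimension-1 / hypersurface character in vacuum is open (KehleUnger2025
§1.4.5, arXiv:2402.10190; Dafermos2025 §6.4), a one-sided or Cantor accumulation of thresholds along
a probe defeats open-density; plus the census (unboundedly many windowed holes beyond every compact
set) and the interior/past hygiene of the clause (H4/H5 of HYGIENE-c2.md). -/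
def CollarThirdLawRobust : Prop :=
  ∀ (X : Type) [TopologicalSpace X] [ChartedSpace E3 X] [IsManifold (𝓡 3) ∞ X] [T2Space X]
    [SecondCountableTopology X] [ConnectedSpace X],
    ∀ d ∈ admissibleVacuumData X, RobustlyEscapable d (Margin₂ (X := X))

/-- **CANDIDATE RESTATED CRUX `GenericCensorshipCollarMargin₂`** — C‴ (label and boost windows before
the tolerance) with the tolerance order pinned to `2`: Christodoulou-generically in the admissible
class, every MGHD has complete `𝓘⁺` and the order-2 windowed bounded-boost collar margin. -/
def GenericCensorshipCollarMargin₂ : Prop :=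
  ∀ (X : Type) [TopologicalSpace X] [ChartedSpace E3 X]
    [IsManifold (𝓡 3) ((⊤ : ℕ∞) : WithTop ℕ∞) X] [T2Space X] [SecondCountableTopology X]
    [ConnectedSpace X],
    InitialDataSet.IsChristodoulouGeneric (admissibleVacuumData X)
      (fun D => ∀ 𝒟 : VacuumCauchyDevelopment D, 𝒟.IsMaximal →
        Summit.FinalStateConjecture.HasCompleteNullInfinity 𝒟.toCauchyDevelopment ∧
        (∀ m₀ ρ₀ : ℝ, 0 < m₀ → 0 < ρ₀ →
          ∃ (χ₁ : ℝ) (δ₁ : ENNReal) (K₁ : Set 𝒟.carrier), χ₁ < 1 ∧ 0 < δ₁ ∧ IsCompact K₁ ∧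
            ∀ (M₁ a₁ : ℝ) (mo₁ : lorentzGroup × E4) (B₁ : ModelBackground)
              (Φ₁ : B₁.domain → 𝒟.carrier), m₀ ≤ M₁ → M₁ ≤ m₀⁻¹ → boostNorm mo₁ ≤ ρ₀ → |a₁| ≤ M₁ →
              B₁ = starBackground mo₁.1 mo₁.2 M₁ a₁
                (fun x => Kerr.radius a₁ (poincareInv mo₁.1 mo₁.2 x)) →
              ContMDiffOn 𝓘(ℝ, E4) (𝓡 4) ((⊤ : ℕ∞) : WithTop ℕ∞) Φ₁
                {x | -1 < B₁.time x.1 ∧ B₁.time x.1 < 1 ∧ B₁.radius x.1 < 3 * M₁ + 1} →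
              Topology.IsOpenEmbedding
                ({x | -1 < B₁.time x.1 ∧ B₁.time x.1 < 1 ∧
                    B₁.radius x.1 < 3 * M₁ + 1}.restrict Φ₁) →
              𝒟.toSpacetime.truncDeviationCk B₁ Φ₁ 2 (3 * M₁) 0 ≤ δ₁ →
              Disjoint (Φ₁ '' B₁.truncTimeSlab (3 * M₁) 0)
                (𝒟.metric.causalPast 𝒟.timeOrientation K₁) →
              |a₁| ≤ χ₁ * M₁)) 1

/-- **The order-2 restated crux is an ASSEMBLY (proved): `CensorshipRobust → CollarThirdLawRobust →
GenericCensorshipCollarMargin₂`.** At each admissible datum conjoin the two robust clauses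
(`RobustlyEscapable.and`), read the target property off pointwise (`mono_of_mem`), and pass to
Christodoulou codimension `≥ 1` by `isChristodoulouGeneric_of_robustlyEscapable` with the landed
`gaugeEnrichment`. -/
theorem genericCensorshipCollarMargin₂_of (hCens : CensorshipRobust) (hThird : CollarThirdLawRobust) :
    GenericCensorshipCollarMargin₂ := by
  intro X _ _ _ _ _ _
  refine isChristodoulouGeneric_of_robustlyEscapable (X := X) ?_ ?_
  · intro d hd
    have hS : RobustlyEscapable d (Scri (X := X)) := by
      have h := hCens X d hd
      dsimp only at h
      exact h
    have hM : RobustlyEscapable d (Margin₂ (X := X)) := hThird X d hd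
    exact (hS.and hM).mono_of_mem fun D _ h 𝒟 hmax => ⟨h.1 𝒟 hmax, h.2 𝒟 hmax⟩
  · intro d hd
    have h := gaugeEnrichment X d hd
    dsimp only at h
    exact h

/-- Read-back: the order-2 restated crux gives generic weak cosmic censorship (first conjunct) —
`IsChristodoulouGeneric.and_left` (Genericity.lean, p123479). -/
theorem scri_generic_of (h : GenericCensorshipCollarMargin₂) (X : Type) [TopologicalSpace X]
    [ChartedSpace E3 X] [IsManifold (𝓡 3) ((⊤ : ℕ∞) : WithTop ℕ∞) X] [T2Space X]
    [SecondCountableTopology X] [ConnectedSpace X] :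
    InitialDataSet.IsChristodoulouGeneric (admissibleVacuumData X) (Scri (X := X)) 1 :=
  (h X).mono fun _ _ hP 𝒟 hmax => (hP 𝒟 hmax).1

end Summit.FinalStateConjecture.FinalStateConjecture.Cruxes.GenericCensorshipCollarMargin.OrderTwoAssembly

end
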